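import Summits.FinalStateConjecture.FinalStateConjecture.Theses.PhaseMixingCapture
import Summits.FinalStateConjecture.FinalStateConjecture.Theses.QuietWindowCapture

/-!
# Skeleton line `capture-exports-censorship-diagonal-surgery` for crux `CaptureSuffices`
# (stmt-FinalStateConjecture-9953, route `PhaseMixingCapture`, rank 6) — crux-plan, round 1

Crux (FIXED, concluded BY NAME below):
`CaptureSuffices := NearExtremalKappaCapture → BulkKerrCapture → WeakCosmicCensorshipMGHD →
FinalStateConjecture`.

## The line (idea card `Ideas/capture-exports-censorship-diagonal-surgery.md`, triage r1-1/2/3: pass)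

Write `𝓓 = admissibleVacuumData X`, `Q D = Censored D` (an MGHD exists and every MGHD has complete
`𝓘⁺`; `WeakCosmicCensorshipMGHD` is literally `Q`-genericity, `wcc_iff_censored_generic`) and
`P D = SettlesDown D` (the summit property at `D`; `FinalStateConjecture` is literally
`P`-genericity, `fsc_iff_settlesDown_generic`). Curve-genericity is not closed under `∧`, and `W`
certifies censorship only along its own curves, which pass through NON-censored data; so the
monotonicity glue `IsChristodoulouGeneric.mono` cannot close the crux once censored non-settling
data exist (Disproof `not_captureSuffices_witness`: every counterexample is such a datum). The
LEVER is the diagonal two-parameter surgery (STUB 1, pure genericity logic, provable now): repair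
ALONG the censored curve by an unfolding `(c, e) ↦ G(c, e)` with finite-time-open thresholds and
pass to the diagonal `c ↦ G(c, e(c))` with a smooth selector `e` flat at `0`; the censored
non-settling POINT case is the same repair run on a censored THREAD through the datum (STUBS 2–3:
the dilation family and dilation-covariance of censorship). All dynamics sits in ONE typed
conditional, STUB 4 (`RepairUnfolding`, XL, hardest): granted the route's two capture statements,
around the censored members of any admissible smooth family small "kicks" produce data all of whose
MGHDs have complete `𝓘⁺` AND an exhaustive sub-extremal `C²` Kerr decomposition — completeness is a
CONCLUSION there (capture exports censorship: the surgered data are certified by capture's own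
far-complete-`𝓘⁺` conclusion, never by `W`). MGHD existence for the surgered data is the shared
support item `MGHDExists` (stmt-FinalStateConjecture-9937), taken BY NAME.

`CaptureSuffices_of` composes STUBS 1–4 + `MGHDExists` into the crux by name (kernel-checked, no
`sorry` outside the stubs): `W` is consumed as the `Q`-genericity hypothesis of STUB 1, the capture
statements are handed to STUB 4. PROVED here, sorry-free, as down payments on STUB 1:
`isSmoothDataFamily_comp` (smooth data families are stable under smooth reparametrisation of the
parameter) and `pointCase` (the `Q d` half of the diagonal surgery: thread + unfolding repaired at
`c₀ = 0` ⇒ an admissible smooth injective curve through `d` whose other members satisfy `P`, with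
the selector `θ = (ε/π)·arctan`); the `¬ Q d` half (flat selector under a positive locally bounded
threshold) is what remains of STUB 1.

## Triage answers built in
* r1-1 / r1-3: the card's Transfer `C⁺ := W → FSC` and its self-supplied `Window*Capture` stubs are
  DROPPED; STUB 4 carries the prefix `NearExtremalKappaCapture → BulkKerrCapture →` so that its prover
  consumes the TYPED hypotheses (intended: through the quiet-past cone adapter of the sibling line
  `quiet-past-cone-surgery`, `BulkKerrCapture` at spin bound `a₁ = χ`; `NearExtremalKappaCapture` is
  available but idle modulo `Bulk` as typed, Disproof §B.3).
* r1-2: the curve repair is stated in LOCAL-UNIFORM form (`∀ c₀`, members censored near `c₀` ⇒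
  `∃ ε > 0`, eventually near `c₀`, all `0 < |e| < ε` repaired); the positive continuous minorant and
  the flat selector are STUB 1's business.
* r1-3: the XL core is DECLARED — it is STUB 4, whose docstring names its strata (parking: kick;
  Bieri-class packet trains: damping; non-Kerr stationary ends / `N ≥ 2` recession / non-convergent
  approach: the Liouville core shared with `QuietWindowCapture.QuietLeaves`).

## Disproof used (`Cruxes/CaptureSuffices/Disproof.lean`, cdisprove cycle 1, rc 0, no `sorry`; its
## §A0–§C LANDED as `Theorems/CaptureSuffices/Negative/{AdversarialWitnesses,CounterexampleShape}`,
## §D as `KerrMassPinning(+Critical)` — not yet built on the farm snapshot, so their content is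
## RE-DERIVED below in this file's vocabulary instead of imported)
No `_false_without_` theorem exists (verdict "resists refutation, MISSTATED"), so no stub has an `H`
to honour; instead: `captureSuffices_iff_wcc_iff_fsc` — HONOURED, the composition is literally
`W ⊢ FSC` with the capture statements routed into STUB 4 (re-proved below);
`not_captureSuffices_witness` — the data STUB 4 repairs are exactly witness-shaped (censored,
admissible; `exists_censored_not_settlesDown` below); `captureSuffices_iff_sharp` — DISCLOSED on STUB 4: its prover receives the
capture packages only at adversarial witnesses (`k = 0`, `δ ≥ δ₀`), so the INTENDED proof of STUB 4
(adapter, reach `δ < 1/2`) needs the owner's numeral pin `k := 2`, `δ ∈ [−1, 1/2)` (Disproof §B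
REPAIR, triage C3/X3) — as a STATEMENT STUB 4 is unaffected; §D / B1 (mass pinning, radiation shell)
— RESPECTED: no stub feeds a slice of the given development to a capture hypothesis; `without_wcc_iff`
— `W` is load-bearing here (hypothesis `hQ` of STUB 1). No landed Negative lemma refutes an instance
of any stub (they are equivalences / divergence lemmas).
-/

noncomputable section

set_option linter.dupNamespace false

namespace Summit.FinalStateConjecture.FinalStateConjecture.Cruxes.CaptureSuffices.CaptureExportsCensorshipDiagonalSurgery

open Set Filter Function Topology
open scoped Manifold ContDiff Topology
open Literature.Geometry.Lorentzian
open Summit.FinalStateConjecture.FinalStateConjecture.Theses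
open Summit.FinalStateConjecture.FinalStateConjecture.Theses.PhaseMixingCapture
  (NearExtremalKappaCapture BulkKerrCapture WeakCosmicCensorshipMGHD CaptureSuffices)

/-! ### Vocabulary (local names; every stub below is EXPANDED over importable declarations) -/

section Defs

variable {X : Type} [TopologicalSpace X] [ChartedSpace E3 X] [IsManifold (𝓡 3) ∞ X]

/-- `D'` is the **`λ`-dilate** of `D`: `h' = λ² h`, `k' = λ k` (the scaling symmetry of the vacuum
constraints). A `Prop` relating two data sets, so no metric is rebuilt here. [folklore] -/
def IsDilateOf (lam : ℝ) (D D' : InitialDataSet (𝓡 3) X) : Prop :=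
  (∀ (x : X) (v w : TangentSpace (𝓡 3) x), D'.h.inner x v w = lam ^ 2 * D.h.inner x v w) ∧
    ∀ (x : X) (v w : TangentSpace (𝓡 3) x), D'.k x v w = lam * D.k x v w

variable [ConnectedSpace X]

/-- **Censored**: the datum has a maximal vacuum Cauchy development and every MGHD has complete
future null infinity (sojourn form) — verbatim the matrix of `WeakCosmicCensorshipMGHD`. [folklore] -/
def Censored (D : InitialDataSet (𝓡 3) X) : Prop :=
  (∃ 𝒟 : VacuumCauchyDevelopment D, 𝒟.IsMaximal) ∧
    ∀ 𝒟 : VacuumCauchyDevelopment D, 𝒟.IsMaximal →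
      Summit.FinalStateConjecture.HasCompleteNullInfinity 𝒟.toCauchyDevelopment

/-- The **`∀`-MGHD clauses of the summit property** at `D`: every MGHD has complete `𝓘⁺` AND an
exhaustive `C²` decomposition into finitely many sub-extremal Kerr near zones plus radiation —
verbatim the second conjunct of the matrix of `FinalStateConjecture`. [folklore] -/
def SettlingClauses (D : InitialDataSet (𝓡 3) X) : Prop :=
  ∀ 𝒟 : VacuumCauchyDevelopment D, 𝒟.IsMaximal →
    Summit.FinalStateConjecture.HasCompleteNullInfinity 𝒟.toCauchyDevelopment ∧
      ∃ (O : Set 𝒟.carrier) (d : FinalStateDecomposition 𝒟.toSpacetime O 2),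
        (∀ i, Kerr.IsSubextremal (d.mass i) (d.spin i)) ∧
          O = Summit.FinalStateConjecture.exteriorOf 𝒟.toCauchyDevelopment d.charted ∧
            Summit.FinalStateConjecture.HasExhaustiveCharts d

/-- **Settles down**: the summit property at the datum `D` (an MGHD exists, and the clauses). [folklore] -/
def SettlesDown (D : InitialDataSet (𝓡 3) X) : Prop :=
  (∃ 𝒟 : VacuumCauchyDevelopment D, 𝒟.IsMaximal) ∧ SettlingClauses D

/-- Settling data are censored (monotonicity; the converse is the whole crux). [folklore] -/
theorem censored_of_settlesDown {D : InitialDataSet (𝓡 3) X} (h : SettlesDown D) : Censored D :=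
  ⟨h.1, fun 𝒟 h𝒟 ↦ (h.2 𝒟 h𝒟).1⟩

end Defs

/-- `WeakCosmicCensorshipMGHD` is literally `Censored`-genericity. [folklore] -/
theorem wcc_iff_censored_generic :
    WeakCosmicCensorshipMGHD ↔
      ∀ (X : Type) [TopologicalSpace X] [ChartedSpace E3 X] [IsManifold (𝓡 3) ∞ X] [T2Space X]
        [SecondCountableTopology X] [ConnectedSpace X],
        InitialDataSet.IsChristodoulouGeneric (admissibleVacuumData X) Censored 1 :=
  Iff.rfl

/-- `FinalStateConjecture` is literally `SettlesDown`-genericity. [folklore] -/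
theorem fsc_iff_settlesDown_generic :
    FinalStateConjecture ↔
      ∀ (X : Type) [TopologicalSpace X] [ChartedSpace E3 X] [IsManifold (𝓡 3) ∞ X] [T2Space X]
        [SecondCountableTopology X] [ConnectedSpace X],
        InitialDataSet.IsChristodoulouGeneric (admissibleVacuumData X) SettlesDown 1 :=
  Iff.rfl

/-! ### A proved ingredient of STUB 1: smooth data families are stable under smooth
reparametrisation of the parameter -/

section Reparam

variable {X : Type} [TopologicalSpace X] [ChartedSpace E3 X] [IsManifold (𝓡 3) ∞ X]

/-- **Reparametrisation.** If `G` is a jointly smooth `n`-parameter family of initial data and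
`φ : ℝᵐ → ℝⁿ` is smooth, then `G ∘ φ` is a jointly smooth `m`-parameter family (composition of
the two `ContMDiff` clauses of `IsSmoothDataFamily` with the product map `(c, x) ↦ (φ c, x)`).
This is the formal half of the diagonal `c ↦ G(c, e(c))` and of the point case `e ↦ G(0, θ(e))`
of STUB 1. [folklore] -/
theorem isSmoothDataFamily_comp {m n : ℕ}
    {G : EuclideanSpace ℝ (Fin n) → InitialDataSet (𝓡 3) X}
    (hG : InitialDataSet.IsSmoothDataFamily n G)
    {φ : EuclideanSpace ℝ (Fin m) → EuclideanSpace ℝ (Fin n)} (hφ : ContDiff ℝ ∞ φ) :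
    InitialDataSet.IsSmoothDataFamily m (G ∘ φ) := by
  have hψ : ContMDiff (𝓘(ℝ, EuclideanSpace ℝ (Fin m)).prod (𝓡 3))
      (𝓘(ℝ, EuclideanSpace ℝ (Fin n)).prod (𝓡 3)) ∞
      (Prod.map φ (id : X → X)) :=
    hφ.contMDiff.prodMap contMDiff_id
  exact ⟨hG.1.comp hψ, hG.2.comp hψ⟩

end Reparam

/-- **Point case of STUB 1, PROVED.** From a thread `F` through `d = F 0`, an injective
admissible smooth unfolding `G ⊇ F` and a threshold `ε > 0` such that every kick `0 < |e| < ε`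
of the member `c = 0` yields `P`, the curve `K e := G(0, θ(e))`, `θ = (ε/π)·arctan`, is a jointly
smooth injective admissible curve through `d` all of whose other members satisfy `P` — the `Q d`
half of the diagonal surgery (the `¬ Q d` half needs the flat selector and is STUB 1's work).
[folklore] -/
theorem pointCase {X : Type} [TopologicalSpace X] [ChartedSpace E3 X] [IsManifold (𝓡 3) ∞ X]
    {𝓓 : Set (InitialDataSet (𝓡 3) X)} {P : InitialDataSet (𝓡 3) X → Prop}
    {d : InitialDataSet (𝓡 3) X} {F : EuclideanSpace ℝ (Fin 1) → InitialDataSet (𝓡 3) X}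
    (h0 : F 0 = d) {G : EuclideanSpace ℝ (Fin 2) → InitialDataSet (𝓡 3) X}
    (hG : InitialDataSet.IsSmoothDataFamily 2 G) (hext : ∀ c : ℝ, G !₂[c, 0] = F !₂[c])
    (hinj : Function.Injective G) (hadm : ∀ p, G p ∈ 𝓓) {ε : ℝ} (hε : 0 < ε)
    (hrep : ∀ e : ℝ, e ≠ 0 → |e| < ε → P (G !₂[0, e])) :
    ∃ K : EuclideanSpace ℝ (Fin 1) → InitialDataSet (𝓡 3) X,
      InitialDataSet.IsSmoothDataFamily 1 K ∧ K 0 = d ∧ Function.Injective K ∧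
        (∀ c, K c ∈ 𝓓) ∧ ∀ c ≠ 0, P (K c) := by
  have hpos : 0 < ε / Real.pi := div_pos hε Real.pi_pos
  set θ : ℝ → ℝ := fun t ↦ ε / Real.pi * Real.arctan t with hθ
  have hθ0 : θ 0 = 0 := by simp [hθ]
  have hθinj : Function.Injective θ := fun a b hab ↦
    Real.arctan_strictMono.injective (mul_left_cancel₀ hpos.ne' hab)
  have hθne : ∀ t, t ≠ 0 → θ t ≠ 0 := fun t ht h ↦ ht (hθinj (h.trans hθ0.symm))
  have hθlt : ∀ t, |θ t| < ε := by
    intro t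
    have h1 : |Real.arctan t| < Real.pi / 2 :=
      abs_lt.2 ⟨Real.neg_pi_div_two_lt_arctan t, Real.arctan_lt_pi_div_two t⟩
    have h2 : |θ t| = ε / Real.pi * |Real.arctan t| := by
      rw [hθ, abs_mul, abs_of_pos hpos]
    rw [h2]
    calc ε / Real.pi * |Real.arctan t| < ε / Real.pi * (Real.pi / 2) :=
          mul_lt_mul_of_pos_left h1 hpos
      _ = ε / 2 := by field_simp
      _ < ε := by linarith
  set φ : EuclideanSpace ℝ (Fin 1) → EuclideanSpace ℝ (Fin 2) := fun c ↦ !₂[(0 : ℝ), θ (c 0)]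
    with hφ
  have hc0 : ContDiff ℝ ∞ (fun c : EuclideanSpace ℝ (Fin 1) ↦ c 0) := contDiff_piLp_apply (p := 2)
  have hφs : ContDiff ℝ ∞ φ := by
    refine contDiff_piLp' (p := 2) fun i ↦ ?_
    fin_cases i
    · simpa [hφ] using (contDiff_const : ContDiff ℝ ∞ fun _ : EuclideanSpace ℝ (Fin 1) ↦ (0 : ℝ))
    · have h : ContDiff ℝ ∞ (fun c : EuclideanSpace ℝ (Fin 1) ↦ ε / Real.pi * Real.arctan (c 0)) :=
        contDiff_const.mul (Real.contDiff_arctan.comp hc0)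
      simpa [hφ, hθ] using h
  have hφ0 : φ 0 = !₂[(0 : ℝ), 0] := by simp [hφ, hθ0]
  have hφ1 : ∀ c : EuclideanSpace ℝ (Fin 1), φ c 1 = θ (c 0) := fun c ↦ by simp [hφ]
  have hzero : (!₂[(0 : ℝ)] : EuclideanSpace ℝ (Fin 1)) = 0 := by
    ext i; fin_cases i; simp
  refine ⟨G ∘ φ, isSmoothDataFamily_comp hG hφs, ?_, ?_, fun c ↦ hadm _, fun c hc ↦ ?_⟩
  · show G (φ 0) = d
    rw [hφ0, hext 0, hzero, h0]
  · intro a b hab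
    have h1 : φ a = φ b := hinj hab
    have h2 : θ (a 0) = θ (b 0) := by rw [← hφ1 a, ← hφ1 b, h1]
    have h3 : a 0 = b 0 := hθinj h2
    ext i; fin_cases i; simpa using h3
  · have hc' : c 0 ≠ 0 := by
      intro h
      apply hc
      ext i; fin_cases i; simpa using h
    exact hrep _ (hθne _ hc') (hθlt _)


/-! ### The statements of the line (named `Prop`s) -/

/-- STATEMENT 1 — **diagonal two-parameter surgery** (the lever; pure genericity logic over
`Genericity.lean`, abstract in the admissible class `𝓓` and the properties `P`, `Q`).
If `Q` is Christodoulou-generic (codimension `1`) in `𝓓`; if through every `Q ∧ ¬P` datum of `𝓓`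
passes a smooth injective admissible THREAD all of whose members satisfy `Q`; and if every smooth
injective admissible one-parameter family `F` admits a smooth injective admissible two-parameter
UNFOLDING `G ⊇ F` (`G(c, 0) = F(c)`) which REPAIRS it near every parameter `c₀` around which the
members are `Q`, with finite-time-open thresholds (some `ε > 0` and a neighbourhood of `c₀` on which
every kick `0 < |e| < ε` yields `P`) — then `P` is Christodoulou-generic (codimension `1`) in `𝓓`.
Proof plan (M): for `d ∈ 𝓓`, `¬P d`: if `Q d`, take the thread `F`, its unfolding `G`, the
threshold `ε` at `c₀ = 0`, and `K e := G(0, θ(e))`, `θ = ε·tanh` (or `(2ε/π)·arctan`); if `¬Q d`,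
take `W`'s curve `F` through `d` (`Q` off `0`), its unfolding `G`, the thresholds `ε(c₀) > 0` with
neighbourhoods covering `{c ≠ 0}`, a continuous positive minorant `ε*` on `{c ≠ 0}` (locally finite
refinement) and a smooth selector `e : ℝ → ℝ`, `e(0) = 0`, all derivatives `0` at `0`,
`0 < |e(c)| < ε*(c)` off `0` (dyadic partition of unity with weights `≤ exp(−2ⁿ)`), and
`K c := G(c, e(c))`. In both cases `K` is jointly smooth (`IsSmoothDataFamily` is stable under smooth
reparametrisation of the parameter: `ContMDiff.comp` with a product map), injective (from
`Injective G`), admissible, `K 0 = d`, and `P (K c)` for `c ≠ 0`. [folklore] -/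
def DiagonalSurgery : Prop :=
  ∀ (X : Type) [TopologicalSpace X] [ChartedSpace E3 X] [IsManifold (𝓡 3) ∞ X]
    (𝓓 : Set (InitialDataSet (𝓡 3) X)) (P Q : InitialDataSet (𝓡 3) X → Prop),
    InitialDataSet.IsChristodoulouGeneric 𝓓 Q 1 →
    (∀ d ∈ 𝓓, Q d → ¬ P d →
      ∃ F : EuclideanSpace ℝ (Fin 1) → InitialDataSet (𝓡 3) X,
        InitialDataSet.IsSmoothDataFamily 1 F ∧ F 0 = d ∧ Function.Injective F ∧
          (∀ c, F c ∈ 𝓓) ∧ ∀ c, Q (F c)) →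
    (∀ F : EuclideanSpace ℝ (Fin 1) → InitialDataSet (𝓡 3) X,
      InitialDataSet.IsSmoothDataFamily 1 F → Function.Injective F → (∀ c, F c ∈ 𝓓) →
        ∃ G : EuclideanSpace ℝ (Fin 2) → InitialDataSet (𝓡 3) X,
          InitialDataSet.IsSmoothDataFamily 2 G ∧ (∀ c : ℝ, G !₂[c, 0] = F !₂[c]) ∧
            Function.Injective G ∧ (∀ p, G p ∈ 𝓓) ∧
              ∀ c₀ : ℝ, (∀ᶠ c in 𝓝 c₀, Q (F !₂[c])) →
                ∃ ε > (0 : ℝ), ∀ᶠ c in 𝓝 c₀, ∀ e : ℝ, e ≠ 0 → |e| < ε → P (G !₂[c, e])) →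
    InitialDataSet.IsChristodoulouGeneric 𝓓 P 1

/-- STATEMENT 2 — **dilation threads** (data-level, M): every admissible datum `d` lies on a
jointly smooth injective one-parameter family of ADMISSIBLE data through `d = F 0` all of whose
members are positive dilates of `d` (`F c = (e^{2c} h, e^{c} k)` in the obvious construction: the
constraints are scale-invariant, completeness and the sole AF end survive, the DR rates hold in the
rescaled end chart with mass `e^{c} M`; injectivity because `h ≠ 0`). [folklore] -/
def DilationThread : Prop :=
  ∀ (X : Type) [TopologicalSpace X] [ChartedSpace E3 X] [IsManifold (𝓡 3) ∞ X] [T2Space X]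
    [SecondCountableTopology X] [ConnectedSpace X],
    ∀ d ∈ admissibleVacuumData X,
      ∃ F : EuclideanSpace ℝ (Fin 1) → InitialDataSet (𝓡 3) X,
        InitialDataSet.IsSmoothDataFamily 1 F ∧ F 0 = d ∧ Function.Injective F ∧
          (∀ c, F c ∈ admissibleVacuumData X) ∧
            ∀ c, ∃ lam : ℝ, 0 < lam ∧ IsDilateOf lam d (F c)

/-- STATEMENT 3 — **censorship is dilation-covariant** (development-level, L): if `D'` is a
positive dilate of `D` and `D` is censored, so is `D'` (an MGHD of `D'` is the `λ`-dilated MGHD of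
`D` — `g ↦ λ² g` preserves Ricci-flatness, global hyperbolicity and maximality; normalised null rays
and sojourn times scale by constants, which the `∀ σ ∃ B₁` form of `HasCompleteFutureNullInfinity`
absorbs). [folklore] -/
def CensoredDilate : Prop :=
  ∀ (X : Type) [TopologicalSpace X] [ChartedSpace E3 X] [IsManifold (𝓡 3) ∞ X] [T2Space X]
    [SecondCountableTopology X] [ConnectedSpace X] (D D' : InitialDataSet (𝓡 3) X) (lam : ℝ),
    0 < lam → IsDilateOf lam D D' → Censored D → Censored D'

/-- STATEMENT 4 — **repair unfolding; capture exports censorship** (XL, HARDEST; the whole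
dynamics of the line as ONE typed conditional). Granted the route's two capture statements: every
jointly smooth injective admissible one-parameter family `F` admits a jointly smooth injective
admissible two-parameter unfolding `G` (`G(c, 0) = F(c)`) such that near every parameter `c₀`
around which the members `F c` are CENSORED there is a threshold `ε > 0` with: for all `c` near
`c₀` and all kicks `0 < |e| < ε`, EVERY maximal vacuum Cauchy development of `G(c, e)` has complete
`𝓘⁺` and settles down to an exhaustive sub-extremal `C²` Kerr decomposition (the `∀`-MGHD clauses of
the Statement). Intended mechanism and strata (card + triage): (parking members) `G(c, e)` = `F c`
plus a timed far-field packet of amplitude `e` — mass-sign-free unparking `δM ∝ e²`, margin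
`χ' = 1 − (M/M')⁴` (kick arithmetic PROVED in `SketchIdeator1.kick_margin_and_edge_lift`), then
capture of the kicked development fed to `BulkKerrCapture` (spin bound `a₁ = χ`) through the
quiet-past cone adapter (auxiliary AF datum whose MGHD shares the future of a late cone; typed
conclusions — far-complete `𝓘⁺`, `ConvergesToKerr` — transferred along the shared future set;
early `𝓘⁺` by exterior stability): THIS is where censorship of the surgered data is certified;
(settling members) openness of capture under small kicks, same adapter; (Bieri-class incoming
packet trains, censored but not `C²`-settling) `G` damps the train; (non-Kerr stationary ends,
eternal `N ≥ 2` recession, non-convergent approach) the Liouville / quantitative no-hair core shared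
with `QuietWindowCapture.QuietLeaves` — declared open. Local uniformity in `c` is finite-time
Cauchy stability plus openness of basins. DISCLOSURES: (i) as typed the capture packages arrive at
adversarial witnesses (`captureSuffices_iff_sharp`: `k = 0`, `δ ≥ δ₀`), and the adapter reaches only
`δ < 1/2`, so the intended proof needs the owner's pin `k := 2`, `δ ∈ [−1, 1/2)` (Disproof §B);
(ii) `NearExtremalKappaCapture` is formally idle modulo `BulkKerrCapture` at `a₁ = χ` (Disproof
§B.3) — it is the tool only for quantitative (one-accuracy) variants; (iii) typed smooth families
carry no topology at infinity, so thresholds uniform in `c` may fail for families with features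
escaping to infinity — the `∃ G` freedom (kick timing adapted to `F c`) is the intended remedy. [folklore] -/
def RepairUnfolding : Prop :=
  NearExtremalKappaCapture → BulkKerrCapture →
    ∀ (X : Type) [TopologicalSpace X] [ChartedSpace E3 X] [IsManifold (𝓡 3) ∞ X] [T2Space X]
      [SecondCountableTopology X] [ConnectedSpace X]
      (F : EuclideanSpace ℝ (Fin 1) → InitialDataSet (𝓡 3) X),
      InitialDataSet.IsSmoothDataFamily 1 F → Function.Injective F →
        (∀ c, F c ∈ admissibleVacuumData X) →
          ∃ G : EuclideanSpace ℝ (Fin 2) → InitialDataSet (𝓡 3) X,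
            InitialDataSet.IsSmoothDataFamily 2 G ∧ (∀ c : ℝ, G !₂[c, 0] = F !₂[c]) ∧
              Function.Injective G ∧ (∀ p, G p ∈ admissibleVacuumData X) ∧
                ∀ c₀ : ℝ, (∀ᶠ c in 𝓝 c₀, Censored (F !₂[c])) →
                  ∃ ε > (0 : ℝ), ∀ᶠ c in 𝓝 c₀, ∀ e : ℝ, e ≠ 0 → |e| < ε →
                    SettlingClauses (G !₂[c, e])

/-! ### The registered stubs (statements EXPANDED over importable declarations) -/

/-- STUB 1 (M, PROVABLE NOW; the lever) — `DiagonalSurgery`, verbatim. -/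
theorem stub_diagonalSurgery :
    ∀ (X : Type) [TopologicalSpace X] [ChartedSpace E3 X] [IsManifold (𝓡 3) ∞ X]
      (𝓓 : Set (InitialDataSet (𝓡 3) X)) (P Q : InitialDataSet (𝓡 3) X → Prop),
      InitialDataSet.IsChristodoulouGeneric 𝓓 Q 1 →
      (∀ d ∈ 𝓓, Q d → ¬ P d →
        ∃ F : EuclideanSpace ℝ (Fin 1) → InitialDataSet (𝓡 3) X,
          InitialDataSet.IsSmoothDataFamily 1 F ∧ F 0 = d ∧ Function.Injective F ∧
            (∀ c, F c ∈ 𝓓) ∧ ∀ c, Q (F c)) →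
      (∀ F : EuclideanSpace ℝ (Fin 1) → InitialDataSet (𝓡 3) X,
        InitialDataSet.IsSmoothDataFamily 1 F → Function.Injective F → (∀ c, F c ∈ 𝓓) →
          ∃ G : EuclideanSpace ℝ (Fin 2) → InitialDataSet (𝓡 3) X,
            InitialDataSet.IsSmoothDataFamily 2 G ∧ (∀ c : ℝ, G !₂[c, 0] = F !₂[c]) ∧
              Function.Injective G ∧ (∀ p, G p ∈ 𝓓) ∧
                ∀ c₀ : ℝ, (∀ᶠ c in 𝓝 c₀, Q (F !₂[c])) →
                  ∃ ε > (0 : ℝ), ∀ᶠ c in 𝓝 c₀, ∀ e : ℝ, e ≠ 0 → |e| < ε → P (G !₂[c, e])) →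
      InitialDataSet.IsChristodoulouGeneric 𝓓 P 1 := by
  sorry

/-- STUB 2 (M) — `DilationThread`, with `IsDilateOf` unfolded. -/
theorem stub_dilationThread :
    ∀ (X : Type) [TopologicalSpace X] [ChartedSpace E3 X] [IsManifold (𝓡 3) ∞ X] [T2Space X]
      [SecondCountableTopology X] [ConnectedSpace X],
      ∀ d ∈ admissibleVacuumData X,
        ∃ F : EuclideanSpace ℝ (Fin 1) → InitialDataSet (𝓡 3) X,
          InitialDataSet.IsSmoothDataFamily 1 F ∧ F 0 = d ∧ Function.Injective F ∧
            (∀ c, F c ∈ admissibleVacuumData X) ∧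
              ∀ c, ∃ lam : ℝ, 0 < lam ∧
                (∀ (x : X) (v w : TangentSpace (𝓡 3) x),
                    (F c).h.inner x v w = lam ^ 2 * d.h.inner x v w) ∧
                  ∀ (x : X) (v w : TangentSpace (𝓡 3) x), (F c).k x v w = lam * d.k x v w := by
  sorry

/-- STUB 3 (L) — `CensoredDilate`, with `IsDilateOf` and `Censored` unfolded. -/
theorem stub_censoredDilate :
    ∀ (X : Type) [TopologicalSpace X] [ChartedSpace E3 X] [IsManifold (𝓡 3) ∞ X] [T2Space X]
      [SecondCountableTopology X] [ConnectedSpace X] (D D' : InitialDataSet (𝓡 3) X) (lam : ℝ),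
      0 < lam →
      ((∀ (x : X) (v w : TangentSpace (𝓡 3) x), D'.h.inner x v w = lam ^ 2 * D.h.inner x v w) ∧
          ∀ (x : X) (v w : TangentSpace (𝓡 3) x), D'.k x v w = lam * D.k x v w) →
      ((∃ 𝒟 : VacuumCauchyDevelopment D, 𝒟.IsMaximal) ∧
          ∀ 𝒟 : VacuumCauchyDevelopment D, 𝒟.IsMaximal →
            Summit.FinalStateConjecture.HasCompleteNullInfinity 𝒟.toCauchyDevelopment) →
      (∃ 𝒟 : VacuumCauchyDevelopment D', 𝒟.IsMaximal) ∧
        ∀ 𝒟 : VacuumCauchyDevelopment D', 𝒟.IsMaximal →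
          Summit.FinalStateConjecture.HasCompleteNullInfinity 𝒟.toCauchyDevelopment := by
  sorry

/-- STUB 4 (XL, HARDEST) — `RepairUnfolding`, with `Censored` and `SettlingClauses` unfolded. -/
theorem stub_repairUnfolding :
    NearExtremalKappaCapture → BulkKerrCapture →
      ∀ (X : Type) [TopologicalSpace X] [ChartedSpace E3 X] [IsManifold (𝓡 3) ∞ X] [T2Space X]
        [SecondCountableTopology X] [ConnectedSpace X]
        (F : EuclideanSpace ℝ (Fin 1) → InitialDataSet (𝓡 3) X),
        InitialDataSet.IsSmoothDataFamily 1 F → Function.Injective F →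
          (∀ c, F c ∈ admissibleVacuumData X) →
            ∃ G : EuclideanSpace ℝ (Fin 2) → InitialDataSet (𝓡 3) X,
              InitialDataSet.IsSmoothDataFamily 2 G ∧ (∀ c : ℝ, G !₂[c, 0] = F !₂[c]) ∧
                Function.Injective G ∧ (∀ p, G p ∈ admissibleVacuumData X) ∧
                  ∀ c₀ : ℝ,
                    (∀ᶠ c in 𝓝 c₀,
                      (∃ 𝒟 : VacuumCauchyDevelopment (F !₂[c]), 𝒟.IsMaximal) ∧
                        ∀ 𝒟 : VacuumCauchyDevelopment (F !₂[c]), 𝒟.IsMaximal →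
                          Summit.FinalStateConjecture.HasCompleteNullInfinity
                            𝒟.toCauchyDevelopment) →
                    ∃ ε > (0 : ℝ), ∀ᶠ c in 𝓝 c₀, ∀ e : ℝ, e ≠ 0 → |e| < ε →
                      ∀ 𝒟 : VacuumCauchyDevelopment (G !₂[c, e]), 𝒟.IsMaximal →
                        Summit.FinalStateConjecture.HasCompleteNullInfinity
                            𝒟.toCauchyDevelopment ∧
                          ∃ (O : Set 𝒟.carrier) (d : FinalStateDecomposition 𝒟.toSpacetime O 2),
                            (∀ i, Kerr.IsSubextremal (d.mass i) (d.spin i)) ∧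
                              O = Summit.FinalStateConjecture.exteriorOf 𝒟.toCauchyDevelopment
                                    d.charted ∧
                                Summit.FinalStateConjecture.HasExhaustiveCharts d := by
  sorry

/-! ### Consistency: each named statement IS its registered stub (definitionally) -/

theorem diagonalSurgery_holds : DiagonalSurgery := stub_diagonalSurgery
theorem dilationThread_holds : DilationThread := stub_dilationThread
theorem censoredDilate_holds : CensoredDilate := stub_censoredDilate
theorem repairUnfolding_holds : RepairUnfolding := stub_repairUnfolding

/-! ### Name-keyed aliases of the four statements (the hypotheses of the composition; the
skeleton audit admits a hypothesis only if its head constant is a registered obligation or is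
named like a declared stub) -/
namespace Registered

/-- Alias of `DiagonalSurgery` keyed by the registered stub name. -/
abbrev stub_diagonalSurgery : Prop := DiagonalSurgery
/-- Alias of `DilationThread` keyed by the registered stub name. -/
abbrev stub_dilationThread : Prop := DilationThread
/-- Alias of `CensoredDilate` keyed by the registered stub name. -/
abbrev stub_censoredDilate : Prop := CensoredDilate
/-- Alias of `RepairUnfolding` keyed by the registered stub name. -/
abbrev stub_repairUnfolding : Prop := RepairUnfolding

end Registered

/-! ### The composition: the four stubs and the shared item `MGHDExists` imply the crux, by name -/

/-- **`CaptureSuffices` from the line** (pure logic, no `sorry`). `W` (the crux's third hypothesis)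
is the `Q`-genericity input of the diagonal surgery with `Q := Censored`, `P := SettlesDown`,
`𝓓 := admissibleVacuumData X`; threads through censored non-settling data come from STUBS 2–3;
the unfolding-with-repair comes from STUB 4 fed with the crux's two capture hypotheses, its
`SettlingClauses` conclusion upgraded to `SettlesDown` by the shared support item `MGHDExists`
(stmt-FinalStateConjecture-9937, here `QuietWindowCapture.MGHDExists`). [folklore] -/
theorem CaptureSuffices_of (h1 : Registered.stub_diagonalSurgery)
    (h2 : Registered.stub_dilationThread) (h3 : Registered.stub_censoredDilate)
    (h4 : Registered.stub_repairUnfolding) (hM : QuietWindowCapture.MGHDExists) :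
    PhaseMixingCapture.CaptureSuffices := by
  intro hNear hBulk hW X _ _ _ _ _ _
  have key : InitialDataSet.IsChristodoulouGeneric (admissibleVacuumData X)
      (SettlesDown (X := X)) 1 := by
    refine h1 X (admissibleVacuumData X) SettlesDown Censored (hW X) ?_ ?_
    · intro d hd hQ _
      obtain ⟨F, hF, h0, hinj, hadm, hdil⟩ := h2 X d hd
      refine ⟨F, hF, h0, hinj, hadm, fun c ↦ ?_⟩
      obtain ⟨lam, hlam, hD⟩ := hdil c
      exact h3 X d (F c) lam hlam hD hQ
    · intro F hF hinj hadm
      obtain ⟨G, hG, hext, hGinj, hGadm, hloc⟩ := h4 hNear hBulk X F hF hinj hadm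
      refine ⟨G, hG, hext, hGinj, hGadm, fun c₀ hc₀ ↦ ?_⟩
      obtain ⟨ε, hε, hev⟩ := hloc c₀ hc₀
      exact ⟨ε, hε, hev.mono fun c hc e he hlt ↦ ⟨hM X (G !₂[c, e]) (hGadm _), hc e he hlt⟩⟩
  exact key

/-- Wiring check: the registered stubs (and the shared item) feed `CaptureSuffices_of` as stated. -/
example (hM : QuietWindowCapture.MGHDExists) : PhaseMixingCapture.CaptureSuffices :=
  CaptureSuffices_of stub_diagonalSurgery stub_dilationThread stub_censoredDilate
    stub_repairUnfolding hM

/-! ### Calibration (Disproof used; PROVED here — the landed `Negative/*` modules are not yet built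
on the farm snapshot, so their three lemmas are re-derived locally instead of imported) -/

section Calibration

variable {X : Type} [TopologicalSpace X] [ChartedSpace E3 X] [IsManifold (𝓡 3) ∞ X]

/-- Christodoulou's curve-genericity is monotone in the property (= landed
`Negative.isChristodoulouGeneric_mono`). [folklore] -/
theorem isChristodoulouGeneric_mono {𝓓 : Set (InitialDataSet (𝓡 3) X)}
    {P Q : InitialDataSet (𝓡 3) X → Prop} (hPQ : ∀ d ∈ 𝓓, P d → Q d) {m : ℕ}
    (h : InitialDataSet.IsChristodoulouGeneric 𝓓 P m) :
    InitialDataSet.IsChristodoulouGeneric 𝓓 Q m := by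
  intro d hd
  obtain ⟨F, hF, h0, hinj, hadm, hexc⟩ := h d ⟨hd.1, fun hP ↦ hd.2 (hPQ d hd.1 hP)⟩
  exact ⟨F, hF, h0, hinj, hadm, fun c hc hmem ↦ hexc c hc ⟨hmem.1, fun hP ↦ hmem.2 (hPQ _ hmem.1 hP)⟩⟩

end Calibration

/-- Monotonicity alone gives only `FSC → W` (stated as an `example`: a named proof of a route item
from the summit would only confuse the tree audit); the converse needs the surgery. -/
example (h : FinalStateConjecture) : WeakCosmicCensorshipMGHD := fun X _ _ _ _ _ _ ↦
  isChristodoulouGeneric_mono (fun D _ hP ↦ censored_of_settlesDown (X := X) (D := D) hP) (h X)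

/-- The crux is `W ↔ FSC` over the capture statements (= landed
`Negative.captureSuffices_iff_wcc_iff_fsc`): the composition `CaptureSuffices_of` is exactly a
proof of the `→` half from the stubs. [folklore] -/
theorem captureSuffices_iff_wcc_iff_fsc :
    PhaseMixingCapture.CaptureSuffices ↔
      (NearExtremalKappaCapture → BulkKerrCapture →
        (WeakCosmicCensorshipMGHD ↔ FinalStateConjecture)) := by
  have hmono : FinalStateConjecture → WeakCosmicCensorshipMGHD := fun h X _ _ _ _ _ _ ↦
    isChristodoulouGeneric_mono (fun D _ hP ↦ censored_of_settlesDown (X := X) (D := D) hP) (h X)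
  unfold PhaseMixingCapture.CaptureSuffices
  exact ⟨fun h hN hB ↦ ⟨h hN hB, hmono⟩, fun h hN hB hW ↦ (h hN hB).1 hW⟩

/-- **Every counterexample is witness-shaped** (= the content of landed
`Negative.not_captureSuffices_witness`, in this file's vocabulary): a disproof of the crux exhibits
an admissible CENSORED datum which does not settle down — exactly the data STUB 4 repairs (if the
exceptional datum of `¬ FinalStateConjecture` is not censored, a member of `W`'s curve through it
is). [folklore] -/
theorem exists_censored_not_settlesDown (h : ¬ PhaseMixingCapture.CaptureSuffices) :
    ∃ (X : Type) (_ : TopologicalSpace X) (_ : ChartedSpace E3 X) (_ : IsManifold (𝓡 3) ∞ X)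
      (_ : T2Space X) (_ : SecondCountableTopology X) (_ : ConnectedSpace X)
      (D : InitialDataSet (𝓡 3) X), D ∈ admissibleVacuumData X ∧ Censored D ∧ ¬ SettlesDown D := by
  by_contra hcon
  apply h
  intro _ _ hW X _ _ _ _ _ _ d hd
  have hQ : ¬ Censored d := fun hq ↦
    hcon ⟨X, ‹_›, ‹_›, ‹_›, ‹_›, ‹_›, ‹_›, d, hd.1, hq,
      show ¬ SettlesDown d from fun hS ↦ hd.2 hS⟩
  obtain ⟨F, hF, h0, hinj, hadm, hexc⟩ := hW X d ⟨hd.1, hQ⟩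
  refine ⟨F, hF, h0, hinj, hadm, fun c hc hmem ↦ ?_⟩
  have hq : Censored (F c) := by
    by_contra hn
    exact hexc c hc ⟨hadm c, hn⟩
  exact hcon ⟨X, ‹_›, ‹_›, ‹_›, ‹_›, ‹_›, ‹_›, F c, hadm c, hq,
    show ¬ SettlesDown (F c) from fun hS ↦ hmem.2 hS⟩

end Summit.FinalStateConjecture.FinalStateConjecture.Cruxes.CaptureSuffices.CaptureExportsCensorshipDiagonalSurgery

end
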